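import Summits.Ventures.Crystal3D.Theorems.StickyWulffConstantCoaxialWallLawSeamCoherentSplit
import HarnessLib

/-!
# The CAPPING CLOSURE as a finite construction, its maximality, and `CoherentAt` ⇔ «closure = window» (crux `CoaxialWallLaw`, stmt-Ventures-19481;
# line `WallLedgerF`, skeleton 'CoaxialWallLawCertificates' v7 → v8, analytic side of the capping-closure split)

HONEST FRAMING. Venture `Summits/Ventures/Crystal3D` (cell `crystal3d-full`); DEFINITIONS + elementary closure lemmas for the crux `CoaxialWallLaw`
(stmt-Ventures-19481, `route-Ventures-StickyWulffConstant`), lane F T5b (cf-p1 (ccxxvii): capping closure = dividing line of record).  Nothing about the stubs is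
claimed; F-C1 not moved.
* `capStep W D = D ∪ {x ∈ W | x caps a unit triangle of D}`, `capIter`, `capClosure W D₀ := capIter W D₀ (#W + 1)`;
* `capStep_capClosure` — the closure is a fixed point (pigeonhole on cardinalities inside `W`); hence MAXIMALITY `mem_capClosure_of_capsTriangleIn` /
  `not_capsTriangleIn_of_not_mem` — a window ball outside the closure caps NO unit triangle of the closure (the structural fact the sparsity half uses: its
  contacts onto closure balls are off-tip);
* `ChainOK` (the capping-order predicate of `CoherentAt`), `chainOK_append`, `exists_chain_of_capIter` — every stage of the iteration is enumerated by a capping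
  order; `subset_capClosure_of_chainOK` — conversely every capping order stays inside the closure;
* **`coherentAt_iff_capClosure`** — `CoherentAt X z ↔ ∃ S, capClosure W (siteBallsAt S z W) = W` with `W = X ∩ B̄(z,3)` and `siteBallsAt S z W` the window balls
  at module sites of the placement: coherence is DECIDED by the canonical closure (cf-p2's growth tree; the analytic side's `D`).
WHAT THIS IS NOT: no cap table, no pools; F-C1 not moved.
-/

noncomputable section

namespace Summit.Ventures.Crystal3D.Theorems

namespace TailResidue

open Summit.Ventures.Crystal3D Finset
open scoped InnerProductSpace

/-! ### Monotonicity of capping -/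

/-- Capping a triangle is monotone in the supporting set. -/
theorem CapsTriangleIn.mono {T T' : Finset (EuclideanSpace ℝ (Fin 3))} {x : EuclideanSpace ℝ (Fin 3)} (h : CapsTriangleIn T x) (hT : T ⊆ T') :
    CapsTriangleIn T' x := by
  obtain ⟨a, ha, b, hb, c, hc, h⟩ := h
  exact ⟨a, hT ha, b, hT hb, c, hT hc, h⟩

/-! ### The closure -/

section Closure

variable (W : Finset (EuclideanSpace ℝ (Fin 3)))

open scoped Classical in
/-- One capping step inside the window `W`. -/
def capStep (D : Finset (EuclideanSpace ℝ (Fin 3))) : Finset (EuclideanSpace ℝ (Fin 3)) := D ∪ W.filter fun x => CapsTriangleIn D x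

/-- Iterated capping steps. -/
def capIter (D₀ : Finset (EuclideanSpace ℝ (Fin 3))) : ℕ → Finset (EuclideanSpace ℝ (Fin 3))
  | 0 => D₀
  | n + 1 => capStep W (capIter D₀ n)

/-- **The capping closure** of `D₀` inside `W` (`#W + 1` steps suffice). -/
def capClosure (D₀ : Finset (EuclideanSpace ℝ (Fin 3))) : Finset (EuclideanSpace ℝ (Fin 3)) := capIter W D₀ (W.card + 1)

variable {W}

/-- A step only adds balls. -/
theorem subset_capStep (D : Finset (EuclideanSpace ℝ (Fin 3))) : D ⊆ capStep W D := subset_union_left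

open scoped Classical in
/-- A step stays inside the window. -/
theorem capStep_subset {D : Finset (EuclideanSpace ℝ (Fin 3))} (hD : D ⊆ W) : capStep W D ⊆ W :=
  union_subset hD (filter_subset _ _)

open scoped Classical in
/-- Membership in a step. -/
theorem mem_capStep_iff {D : Finset (EuclideanSpace ℝ (Fin 3))} {x : EuclideanSpace ℝ (Fin 3)} :
    x ∈ capStep W D ↔ x ∈ D ∨ (x ∈ W ∧ CapsTriangleIn D x) := by
  simp only [capStep, mem_union, mem_filter]

/-- The successor stage. -/
theorem capIter_succ (D₀ : Finset (EuclideanSpace ℝ (Fin 3))) (n : ℕ) : capIter W D₀ (n + 1) = capStep W (capIter W D₀ n) := rfl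

/-- Stages grow. -/
theorem subset_capIter_succ (D₀ : Finset (EuclideanSpace ℝ (Fin 3))) (n : ℕ) : capIter W D₀ n ⊆ capIter W D₀ (n + 1) :=
  subset_capStep _

/-- Every stage contains the seed. -/
theorem subset_capIter (D₀ : Finset (EuclideanSpace ℝ (Fin 3))) (n : ℕ) : D₀ ⊆ capIter W D₀ n := by
  induction n with
  | zero => exact Subset.rfl
  | succ n ih => exact ih.trans (subset_capIter_succ D₀ n)

/-- Stages are monotone in the index. -/
theorem capIter_mono (D₀ : Finset (EuclideanSpace ℝ (Fin 3))) {m n : ℕ} (h : m ≤ n) : capIter W D₀ m ⊆ capIter W D₀ n := by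
  induction h with
  | refl => exact Subset.rfl
  | step _ ih => exact ih.trans (subset_capIter_succ D₀ _)

/-- Stages stay inside the window. -/
theorem capIter_subset {D₀ : Finset (EuclideanSpace ℝ (Fin 3))} (hD : D₀ ⊆ W) (n : ℕ) : capIter W D₀ n ⊆ W := by
  induction n with
  | zero => exact hD
  | succ n ih => exact capStep_subset ih

/-- Once a step adds nothing, no later step does. -/
theorem capIter_stable (D₀ : Finset (EuclideanSpace ℝ (Fin 3))) {n : ℕ} (h : capIter W D₀ (n + 1) = capIter W D₀ n) (k : ℕ) :
    capIter W D₀ (n + k) = capIter W D₀ n := by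
  induction k with
  | zero => rfl
  | succ k ih => rw [← add_assoc, capIter_succ, ih, ← capIter_succ, h]

/-- **The closure is a fixed point of the capping step** (pigeonhole: strictly growing stages inside `W` cannot exceed `#W + 1`). -/
theorem capStep_capClosure {D₀ : Finset (EuclideanSpace ℝ (Fin 3))} (hD : D₀ ⊆ W) : capStep W (capClosure W D₀) = capClosure W D₀ := by
  obtain ⟨n, hn, hfix⟩ : ∃ n ≤ W.card, capIter W D₀ (n + 1) = capIter W D₀ n := by
    by_contra h
    push Not at h
    have hgrow : ∀ n ≤ W.card + 1, n ≤ (capIter W D₀ n).card := by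
      intro n hn
      induction n with
      | zero => exact Nat.zero_le _
      | succ n ih =>
        have hlt : (capIter W D₀ n).card < (capIter W D₀ (n + 1)).card :=
          card_lt_card (lt_of_le_of_ne (subset_capIter_succ D₀ n) (Ne.symm (h n (by omega))))
        have := ih (by omega)
        omega
    have h1 := hgrow (W.card + 1) le_rfl
    have h2 : (capIter W D₀ (W.card + 1)).card ≤ W.card := card_le_card (capIter_subset hD _)
    omega
  have hclo : capClosure W D₀ = capIter W D₀ n := by
    rw [capClosure, show W.card + 1 = n + (W.card + 1 - n) by omega]
    exact capIter_stable D₀ hfix _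
  rw [hclo, ← capIter_succ, hfix]

/-- **Maximality**: a window ball capping a unit triangle of the closure belongs to the closure. -/
theorem mem_capClosure_of_capsTriangleIn {D₀ : Finset (EuclideanSpace ℝ (Fin 3))} (hD : D₀ ⊆ W) {x : EuclideanSpace ℝ (Fin 3)} (hx : x ∈ W)
    (hcap : CapsTriangleIn (capClosure W D₀) x) : x ∈ capClosure W D₀ := by
  rw [← capStep_capClosure hD, mem_capStep_iff]
  exact Or.inr ⟨hx, hcap⟩

/-- **Maximality, contrapositive**: a window ball outside the closure caps no unit triangle of the closure. -/
theorem not_capsTriangleIn_of_not_mem {D₀ : Finset (EuclideanSpace ℝ (Fin 3))} (hD : D₀ ⊆ W) {x : EuclideanSpace ℝ (Fin 3)} (hx : x ∈ W)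
    (hxc : x ∉ capClosure W D₀) : ¬ CapsTriangleIn (capClosure W D₀) x := fun h => hxc (mem_capClosure_of_capsTriangleIn hD hx h)

/-- The closure contains the seed. -/
theorem subset_capClosure (D₀ : Finset (EuclideanSpace ℝ (Fin 3))) : D₀ ⊆ capClosure W D₀ := subset_capIter D₀ _

/-- The closure stays inside the window. -/
theorem capClosure_subset {D₀ : Finset (EuclideanSpace ℝ (Fin 3))} (hD : D₀ ⊆ W) : capClosure W D₀ ⊆ W := capIter_subset hD _

end Closure

/-! ### Capping orders -/

/-- **CAPPING ORDER** over the site set `sites`: every entry of the list is a site ball or caps a unit triangle of EARLIER entries (the predicate of `CoherentAt`). -/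
def ChainOK (sites : Finset (EuclideanSpace ℝ (Fin 3))) (l : List (EuclideanSpace ℝ (Fin 3))) : Prop :=
  ∀ i : Fin l.length, l.get i ∈ sites ∨ CapsTriangleIn (l.take i).toFinset (l.get i)

/-- The empty list is a capping order. -/
theorem chainOK_nil (sites : Finset (EuclideanSpace ℝ (Fin 3))) : ChainOK sites [] := fun i => i.elim0

/-- Appending balls that are sites or cap a triangle of the list so far keeps the capping order. -/
theorem chainOK_append {sites : Finset (EuclideanSpace ℝ (Fin 3))} {l m : List (EuclideanSpace ℝ (Fin 3))} (hl : ChainOK sites l)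
    (hm : ∀ x ∈ m, x ∈ sites ∨ CapsTriangleIn l.toFinset x) : ChainOK sites (l ++ m) := by
  intro i
  by_cases hi : (i : ℕ) < l.length
  · have hget : (l ++ m).get i = l.get ⟨i, hi⟩ := by
      simp only [List.get_eq_getElem]; exact List.getElem_append_left hi
    have htake : (l ++ m).take i = l.take i := List.take_append_of_le_length hi.le
    rw [hget, htake]
    exact hl ⟨i, hi⟩
  · push Not at hi
    have hi2 : (i : ℕ) - l.length < m.length := by
      have := i.isLt; simp only [List.length_append] at this; omega
    have hget : (l ++ m).get i = m.get ⟨i - l.length, hi2⟩ := by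
      simp only [List.get_eq_getElem]; exact List.getElem_append_right hi
    rw [hget]
    rcases hm _ (List.get_mem m _) with hs | hc
    · exact Or.inl hs
    · refine Or.inr (hc.mono fun y hy => ?_)
      rw [List.mem_toFinset] at hy ⊢
      rw [List.take_append, List.take_of_length_le hi]
      exact List.mem_append_left _ hy

/-- **Every stage of the iteration is enumerated by a capping order** (when `D₀ ⊆ sites`). -/
theorem exists_chain_of_capIter {W sites D₀ : Finset (EuclideanSpace ℝ (Fin 3))} (hD : D₀ ⊆ sites) (n : ℕ) :
    ∃ l : List (EuclideanSpace ℝ (Fin 3)), ChainOK sites l ∧ ∀ x, x ∈ l ↔ x ∈ capIter W D₀ n := by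
  classical
  induction n with
  | zero =>
    refine ⟨D₀.toList, fun i => Or.inl (hD (Finset.mem_toList.1 (List.get_mem _ _))), fun x => ?_⟩
    rw [Finset.mem_toList]; rfl
  | succ n ih =>
    obtain ⟨l, hl, hmem⟩ := ih
    refine ⟨l ++ ((capIter W D₀ (n + 1)) \ capIter W D₀ n).toList, chainOK_append hl fun x hx => ?_, fun x => ?_⟩
    · rw [Finset.mem_toList, mem_sdiff, capIter_succ, mem_capStep_iff] at hx
      rcases hx.1 with h | ⟨-, hc⟩
      · exact absurd h hx.2
      · refine Or.inr (hc.mono fun y hy => ?_)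
        rw [List.mem_toFinset]; exact (hmem y).2 hy
    · rw [List.mem_append, Finset.mem_toList, mem_sdiff, hmem]
      constructor
      · rintro (h | ⟨h, -⟩)
        · exact subset_capIter_succ D₀ n h
        · exact h
      · intro h
        by_cases h' : x ∈ capIter W D₀ n
        · exact Or.inl h'
        · exact Or.inr ⟨h, h'⟩

/-- **Conversely, a capping order of window balls stays inside the closure of the site balls it uses.** -/
theorem subset_capClosure_of_chainOK {W sites : Finset (EuclideanSpace ℝ (Fin 3))} {l : List (EuclideanSpace ℝ (Fin 3))} (hl : ChainOK sites l)
    (hlW : ∀ x ∈ l, x ∈ W) {D₀ : Finset (EuclideanSpace ℝ (Fin 3))} (hD : D₀ ⊆ W) (hsites : ∀ x ∈ l, x ∈ sites → x ∈ D₀) :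
    ∀ x ∈ l, x ∈ capClosure W D₀ := by
  -- strong induction on the index
  suffices h : ∀ n : ℕ, ∀ i : Fin l.length, (i : ℕ) < n → l.get i ∈ capClosure W D₀ by
    intro x hx
    obtain ⟨i, rfl⟩ := List.mem_iff_get.1 hx
    exact h (i + 1) i (Nat.lt_succ_self _)
  intro n
  induction n with
  | zero => intro i hi; exact absurd hi (Nat.not_lt_zero _)
  | succ n ih =>
    intro i hi
    have hxl : l.get i ∈ l := List.get_mem _ _
    rcases hl i with hs | hc
    · exact subset_capClosure D₀ (hsites _ hxl hs)
    · refine mem_capClosure_of_capsTriangleIn hD (hlW _ hxl) (hc.mono fun y hy => ?_)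
      rw [List.mem_toFinset] at hy
      obtain ⟨j, hj, rfl⟩ := List.mem_iff_getElem.1 hy
      rw [List.getElem_take]
      have hjlen : j < l.length := by rw [List.length_take] at hj; omega
      have hji : j < (i : ℕ) := by rw [List.length_take] at hj; omega
      have h := ih ⟨j, hjlen⟩ (show j < n by omega)
      simpa [List.get_eq_getElem] using h

/-! ### Coherence is decided by the closure -/

open scoped Classical in
/-- The window balls at MODULE SITES of the placement `S` (payer `z ↦ 0`). -/
def siteBallsAt (S : EuclideanSpace ℝ (Fin 3) ≃ₗᵢ[ℝ] EuclideanSpace ℝ (Fin 3)) (z : EuclideanSpace ℝ (Fin 3)) (W : Finset (EuclideanSpace ℝ (Fin 3))) :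
    Finset (EuclideanSpace ℝ (Fin 3)) :=
  W.filter fun x => S.symm x + -S.symm z ∈ modSite '' (↑siteBall : Set (ℤ × ℤ × ℤ))

open scoped Classical in
/-- Site balls are window balls. -/
theorem siteBallsAt_subset (S : EuclideanSpace ℝ (Fin 3) ≃ₗᵢ[ℝ] EuclideanSpace ℝ (Fin 3)) (z : EuclideanSpace ℝ (Fin 3))
    (W : Finset (EuclideanSpace ℝ (Fin 3))) : siteBallsAt S z W ⊆ W := filter_subset _ _

open scoped Classical in
/-- **`CoherentAt` ⇔ the capping closure of the site balls is the whole window.** -/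
theorem coherentAt_iff_capClosure (X : Finset (EuclideanSpace ℝ (Fin 3))) (z : EuclideanSpace ℝ (Fin 3)) :
    CoherentAt X z ↔ ∃ S : EuclideanSpace ℝ (Fin 3) ≃ₗᵢ[ℝ] EuclideanSpace ℝ (Fin 3),
      capClosure (X.filter fun x => dist z x ≤ 3) (siteBallsAt S z (X.filter fun x => dist z x ≤ 3)) = X.filter fun x => dist z x ≤ 3 := by
  set W := X.filter fun x => dist z x ≤ 3 with hW
  constructor
  · rintro ⟨S, l, hl, hchain⟩
    refine ⟨S, Subset.antisymm (capClosure_subset (siteBallsAt_subset S z W)) fun x hx => ?_⟩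
    have hlW : ∀ x ∈ l, x ∈ W := fun x hx => by rw [hW, mem_filter]; exact (hl x).1 hx
    have hchain' : ChainOK (siteBallsAt S z W) l := by
      intro i
      rcases hchain i with hs | hc
      · exact Or.inl (mem_filter.2 ⟨hlW _ (List.get_mem _ _), hs⟩)
      · exact Or.inr hc
    refine subset_capClosure_of_chainOK hchain' hlW (siteBallsAt_subset S z W) (fun _ _ h => h) x ?_
    have hx' := hx
    rw [hW, mem_filter] at hx'
    exact (hl x).2 hx'
  · rintro ⟨S, hS⟩
    obtain ⟨l, hl, hmem⟩ := exists_chain_of_capIter (W := W) (sites := siteBallsAt S z W) (D₀ := siteBallsAt S z W) Subset.rfl (W.card + 1)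
    refine ⟨S, l, fun x => ?_, fun i => ?_⟩
    · rw [hmem, ← capClosure, hS, hW, mem_filter]
    · rcases hl i with hs | hc
      · exact Or.inl (mem_filter.1 hs).2
      · exact Or.inr hc

end TailResidue

end Summit.Ventures.Crystal3D.Theorems

end
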